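import Literature.Analysis.OperatorTheory.CompactPositiveSubspaceMinMax
import Mathlib.Analysis.InnerProductSpace.Adjoint
import Mathlib.Analysis.InnerProductSpace.Positive
import Mathlib.Topology.Algebra.Order.Field
import HarnessLib

/-!
# The min–max levels of a closed form with compact embedding (`(Q, J)` format, any `RCLike 𝕜`)

Setting (Kato's first representation theorem in the format of
`Literature.Analysis.OperatorTheory.CompactEmbeddingFormSpectrum` /
`Literature.Analysis.UnboundedOperators.ClosableFormCriteria`): `Q` is the completed form domain
of a closed nonnegative form `𝔮` — a Hilbert space with `‖x‖_Q² = 𝔮(x) + ‖J x‖_H²` — and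
`J : Q →L[𝕜] H` its embedding into the ambient Hilbert space, INJECTIVE (closability) and COMPACT
(Rellich).  Then `K = J†J` is a compact positive injective operator on `Q`, and the orthonormal
eigen-sequence of `K` (`Literature.Analysis.OperatorTheory.exists_orthonormal_eigenseq`) IS the
sequence of form-eigenvectors of `𝔮`, with levels `μ_k = 1/κ_k - 1 ↑ +∞` (Reed–Simon IV,
Thm XIII.64 (iv) ⇒ (v)), and — by the subspace form of min–max,
`Literature.Analysis.OperatorTheory.isLUB_subspace_rayleigh_of_dense` — for every dense subspace
(form core) `D ⊆ Q`,

  `μ_k = inf {s | ∃ W ⊆ D, dim W = k + 1, ∀ x ∈ W, 𝔮(x) ≤ s ‖J x‖²}`   (`𝔮(x) = ‖x‖² - ‖Jx‖²`),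

i.e. EXACTLY the subspace-form min–max value over the core (Reed–Simon IV, Thms XIII.1–XIII.2;
in the tree: the shape of `Literature.Analysis.OperatorTheory.YMMatrixModel.minmaxLevel`).

Main result: `exists_form_eigenseq`.  No definitions, no named facts.

## References
* [ReedSimonIV1978] M. Reed, B. Simon, *Methods of Modern Mathematical Physics IV*, §XIII.1
  Thms XIII.1–XIII.2 (held p0083–p0084) and §XIII.14 Thm XIII.64 ((iv) ⇒ (v): compact form-norm
  balls ⇒ complete set of eigenvectors with `μ_n → ∞`), p. 245 (held p0231).
* [Kato1966] T. Kato, *Perturbation Theory for Linear Operators*, VI §2.1 Thm 2.1 (first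
  representation theorem), held p0378–p0380.
-/

noncomputable section

open scoped InnerProductSpace ComplexConjugate
open Filter _root_.Topology

namespace Literature.Analysis.OperatorTheory

variable {𝕜 : Type*} [RCLike 𝕜]
variable {Q : Type*} [NormedAddCommGroup Q] [InnerProductSpace 𝕜 Q] [CompleteSpace Q]
variable {H : Type*} [NormedAddCommGroup H] [InnerProductSpace 𝕜 H] [CompleteSpace H]

omit [CompleteSpace Q] in
/-- A `(k+1)`-dimensional subspace has a nonzero element. [cite: ReedSimonIV1978, Thm. XIII.1 (proof)] -/
private theorem exists_mem_ne_zero_of_finrank_eq_succ {k : ℕ} (W : Submodule 𝕜 Q)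
    (hW : Module.finrank 𝕜 W = k + 1) : ∃ x ∈ W, x ≠ 0 := by
  obtain ⟨x, hxW, hx0, -⟩ :=
    exists_mem_ne_zero_forall_inner_eq_zero W hW (fun _ : Fin k => (0 : Q))
  exact ⟨x, hxW, hx0⟩

/-- ★★ **Form-eigenvectors and min–max levels of a closed form with compact injective embedding**
(Reed–Simon IV, Thm XIII.64 (iv)⇒(v) with Thms XIII.1–XIII.2).  For `Q` infinite-dimensional and
`J : Q →L[𝕜] H` compact and injective there are an orthonormal sequence `e : ℕ → Q` and levels
`μ : ℕ → ℝ`, monotone, `> -1`, `μ_k → +∞`, such that: the `J e_k` are pairwise orthogonal in `H`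
with `‖J e_k‖² = (μ_k + 1)⁻¹`; the weak eigen-equation `⟪e_k, y⟫_Q = (μ_k + 1) ⟪J e_k, J y⟫_H`
holds for all `y ∈ Q` (i.e. `𝔮(e_k, y) = μ_k ⟪J e_k, J y⟫` with `𝔮(x, y) = ⟪x, y⟫_Q - ⟪Jx, Jy⟫_H`);
and for every dense subspace `D` of `Q` and every `k`, `μ_k` is the INFIMUM of the `s` for which
some `(k+1)`-dimensional `W ⊆ D` has `‖x‖_Q² - ‖J x‖² ≤ s ‖J x‖²` on `W` (subspace form of min–max
over the form core `D`).
[cite: ReedSimonIV1978, Thm. XIII.64 ((iv) ⇒ (v)), §XIII.14 p. 245; Thm. XIII.1–XIII.2 (min–max, subspace form over a form core)] -/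
theorem exists_form_eigenseq (hQ : ¬ FiniteDimensional 𝕜 Q) (J : Q →L[𝕜] H)
    (hJc : IsCompactOperator J) (hJi : Function.Injective J) :
    ∃ (e : ℕ → Q) (μ : ℕ → ℝ), Orthonormal 𝕜 e ∧ Monotone μ ∧ (∀ k, -1 < μ k) ∧
      Tendsto μ atTop atTop ∧
      (∀ k, ‖J (e k)‖ ^ 2 = (μ k + 1)⁻¹) ∧
      (∀ i j, i ≠ j → ⟪J (e i), J (e j)⟫_𝕜 = 0) ∧
      (∀ k (y : Q), ⟪e k, y⟫_𝕜 = ((μ k + 1 : ℝ) : 𝕜) * ⟪J (e k), J y⟫_𝕜) ∧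
      ∀ (D : Submodule 𝕜 Q), Dense (D : Set Q) → ∀ k,
        IsGLB {s : ℝ | ∃ W : Submodule 𝕜 Q, Module.finrank 𝕜 W = k + 1 ∧ W ≤ D ∧
          ∀ x ∈ W, ‖x‖ ^ 2 - ‖J x‖ ^ 2 ≤ s * ‖J x‖ ^ 2} (μ k) := by
  -- `K = J†J`: compact, self-adjoint, positive
  set K : Q →L[𝕜] Q := (ContinuousLinearMap.adjoint J).comp J with hK
  have hKc : IsCompactOperator K := hJc.clm_comp (ContinuousLinearMap.adjoint J)
  have hKsa : IsSelfAdjoint K := (ContinuousLinearMap.isPositive_adjoint_comp_self J).isSelfAdjoint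
  have hKin : ∀ x y : Q, ⟪x, K y⟫_𝕜 = ⟪J x, J y⟫_𝕜 := fun x y => by
    simp only [hK, ContinuousLinearMap.coe_comp, Function.comp_apply,
      ContinuousLinearMap.adjoint_inner_right]
  have hKsq : ∀ x : Q, RCLike.re ⟪x, K x⟫_𝕜 = ‖J x‖ ^ 2 := fun x => by
    rw [hKin, inner_self_eq_norm_sq]
  have hKpos : ∀ x : Q, 0 ≤ RCLike.re ⟪x, K x⟫_𝕜 := fun x => by rw [hKsq]; positivity
  -- the eigen-sequence of `K`
  obtain ⟨e, ev, hon, heig, hanti, hdom⟩ := exists_orthonormal_eigenseq hQ hKsa hKc hKpos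
  have hevJ : ∀ k, ‖J (e k)‖ ^ 2 = ev k := fun k => by
    rw [← hKsq, heig, inner_smul_right, inner_self_eq_norm_sq_to_K, hon.1 k]
    simp
  have hev0 : ∀ k, 0 < ev k := fun k => by
    rw [← hevJ]
    refine pow_pos (norm_pos_iff.2 fun h0 => ?_) 2
    have : e k = 0 := hJi (by rw [h0, map_zero])
    have h1 := hon.1 k
    rw [this, norm_zero] at h1
    exact zero_ne_one h1
  -- the levels
  refine ⟨e, fun k => (ev k)⁻¹ - 1, hon, ?_, ?_, ?_, ?_, ?_, ?_, ?_⟩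
  · -- monotone
    intro k l hkl
    have := inv_anti₀ (hev0 l) (hanti hkl)
    linarith
  · intro k; have := inv_pos.2 (hev0 k); linarith
  · -- `μ_k → ∞`
    have h0 : Tendsto ev atTop (𝓝 0) :=
      tendsto_ev_atTop_zero hKc hon heig hanti fun k => (hev0 k).le
    have h1 : Tendsto (fun k => (ev k)⁻¹) atTop atTop :=
      tendsto_inv_nhdsGT_zero.comp (tendsto_nhdsWithin_iff.2 ⟨h0, Eventually.of_forall hev0⟩)
    have h2 := tendsto_atTop_add_const_right atTop (-1 : ℝ) h1
    simpa [sub_eq_add_neg] using h2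
  · intro k; rw [sub_add_cancel, inv_inv]; exact hevJ k
  · intro i j hij
    rw [← hKin, heig, inner_smul_right, hon.2 hij, mul_zero]
  · intro k y
    have h1 : ⟪J (e k), J y⟫_𝕜 = ((ev k : ℝ) : 𝕜) * ⟪e k, y⟫_𝕜 := by
      rw [← ContinuousLinearMap.adjoint_inner_left, ← ContinuousLinearMap.comp_apply, ← hK, heig,
        inner_smul_left, RCLike.conj_ofReal]
    rw [h1, ← mul_assoc, sub_add_cancel, ← RCLike.ofReal_mul, inv_mul_cancel₀ (hev0 k).ne',
      RCLike.ofReal_one, one_mul]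
  · -- the min–max levels over a dense core
    intro D hD k
    have hlub := isLUB_subspace_rayleigh_of_dense hKpos hon heig hanti hdom D hD k
    constructor
    · -- lower bound
      rintro s ⟨W, hW, hWD, hWs⟩
      obtain ⟨x₀, hx₀W, hx₀⟩ := exists_mem_ne_zero_of_finrank_eq_succ W hW
      -- `1 + s > 0`
      have hs1 : 0 < 1 + s := by
        have h1 := hWs x₀ hx₀W
        have h2 : 0 < ‖x₀‖ ^ 2 := pow_pos (norm_pos_iff.2 hx₀) 2
        by_contra hneg
        push Not at hneg
        have h3 : (1 + s) * ‖J x₀‖ ^ 2 ≤ 0 :=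
          mul_nonpos_of_nonpos_of_nonneg hneg (sq_nonneg _)
        nlinarith
      -- `(1 + s)⁻¹` is an admissible `t`
      have ht : (1 + s)⁻¹ ∈ {t : ℝ | ∃ W : Submodule 𝕜 Q, Module.finrank 𝕜 W = k + 1 ∧ W ≤ D ∧
          ∀ x ∈ W, t * ‖x‖ ^ 2 ≤ RCLike.re ⟪x, K x⟫_𝕜} := by
        refine ⟨W, hW, hWD, fun x hx => ?_⟩
        rw [hKsq, inv_mul_le_iff₀ hs1]
        have := hWs x hx
        nlinarith
      have h4 : (1 + s)⁻¹ ≤ ev k := hlub.1 ht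
      have h5 : (ev k)⁻¹ ≤ 1 + s := by
        have := inv_anti₀ (inv_pos.2 hs1) h4
        rwa [inv_inv] at this
      linarith
    · -- greatest lower bound
      intro b hb
      by_contra hcon
      push Not at hcon
      -- `t = (b + 1)⁻¹ < ev k`
      have hb1 : 0 < b + 1 := by have := inv_pos.2 (hev0 k); linarith
      have htk : (b + 1)⁻¹ < ev k := by
        rw [inv_lt_comm₀ hb1 (hev0 k)]; linarith
      obtain ⟨t', ht'S, htt', -⟩ := hlub.exists_between htk
      obtain ⟨W, hW, hWD, hWt'⟩ := ht'S
      have ht'0 : 0 < t' := (inv_pos.2 hb1).trans htt'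
      -- `t'⁻¹ - 1` is an admissible `s`
      have hsS : t'⁻¹ - 1 ∈ {s : ℝ | ∃ W : Submodule 𝕜 Q, Module.finrank 𝕜 W = k + 1 ∧ W ≤ D ∧
          ∀ x ∈ W, ‖x‖ ^ 2 - ‖J x‖ ^ 2 ≤ s * ‖J x‖ ^ 2} := by
        refine ⟨W, hW, hWD, fun x hx => ?_⟩
        have h1 := hWt' x hx
        rw [hKsq] at h1
        have h2 : ‖x‖ ^ 2 ≤ t'⁻¹ * ‖J x‖ ^ 2 := by
          rw [le_inv_mul_iff₀ ht'0]; exact h1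
        nlinarith
      have h6 := hb hsS
      have h7 : t'⁻¹ < (b + 1)⁻¹⁻¹ := inv_strictAnti₀ (inv_pos.2 hb1) htt'
      rw [inv_inv] at h7
      linarith

end Literature.Analysis.OperatorTheory

end
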